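import Summits.CriticalPhenomena.PercolationContinuityZ3.Theorems.PercLowPointHalfSpaceTallClusterMassBoundWallArmPartial

/-!
# `TallClusterMassBound` (stmt-CriticalPhenomena-0912), line `replica-overlap-cs-transfer` —
# the product floor `P_{p_c}(0 ↔ ∂Λ_a) · π_s(a) ≥ c / a²` (bulk one-arm × wall one-arm)

Registered CLOSED-helper sub-goal `bulkArm_mul_wallArm_lower` of the line: the one-scale floor under the
stub `stub_wallArmLowerRegularity`, sharpened by the bulk one-arm. At `p_c(ℤ³)`, for every `a ≥ 1`,

  `(1/5292) / a² ≤ P_{p_c}(siteToBoundary 3 a) · armProb (criticalProbI 3) a`,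

i.e. (bulk one-arm exponent) + (wall one-arm exponent) `≤ 2 = d - 1` (numerically `0.48 + 0.98`).
It upgrades the landed wall-arm floor `π_s(a) ≥ 1/(588 a²)` (`armProb_criticalProbI_ge`) by the factor
`1/P_{p_c}(0 ↔ ∂Λ_a)`, and conversely turns any polynomial rate for the wall arm into a LOWER bound on the
bulk one-arm.

Proof (Duminil-Copin–Tassion `φ_{p_c}(Λ_N) ≥ 1` + independence in disjoint balls + a face isomorphism),
with `N = 2a + 1`:
* `real_openConnIn_le_siteToBoundary_mul_armH` : for a boundary pair `x ∈ Λ_N ∌ y`, `x ∼ y` (so `x_i = ±N`),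
  `P(0 ⟷ x in Λ_N) ≤ P(0 ↔ ∂Λ_a) · P(arm_H(0, a))`. An open path in `Λ_N` from `0` to `x` first exits
  `Λ_a` (giving `{0 ↔ ∂Λ_a}`, `DCT16.armEvent_of_pathIn`) and, read backwards from `x`, first exits
  `x + Λ_a` inside `Λ_N` (giving a path inside `F = Λ_N ∩ (x + Λ_a)` from `x` to `x + ∂Λ_a`). The two
  events are determined by the disjoint edge sets `Λ_a.sym2`, `F.sym2` (`|x_i| = 2a+1`), hence independent
  (`DCT16.real_inter_of_determinedBy_disjoint`), and the face isomorphism `faceIso x i s` (`s x_i = -N`)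
  maps `F ⊆ Λ_N` into `ℍ`, `x` to `0` and `x + ∂Λ_a` to sup-distance `a`: the second event has probability
  at most `P(arm_H(0, a))` (`bondPercolation_real_preimage_relabel_iso`).
* `bulkArm_mul_wallArm_lower` : sum over the `≤ 588 (2a+1)² ≤ 5292 a²` boundary pairs of `Λ_N`
  (`sum_card_filter_le`) in `1 ≤ φ_{p_c}(Λ_N)` (`one_le_phi_criticalProbI`), as in `armH_lower_bound`.
* `armProb_criticalProbI_ge_div_bulkArm` : the same floor divided through, `c/(a² P(0 ↔ ∂Λ_a)) ≤ π_s(a)`.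
-/

noncomputable section

open MeasureTheory
open Literature.Probability.Percolation Literature.Probability.LatticeModels
open Summit.CriticalPhenomena.PercolationContinuityZ3.Theorems.TallClusterMassBound.Negative
open Summit.CriticalPhenomena.PercolationContinuityZ3.Theorems.QuantitativeBGN.Negative

namespace Summit.CriticalPhenomena.PercolationContinuityZ3.Theorems.TallClusterMassBound.ReplicaOverlap

/-! ## The face isomorphism on translated spheres -/

/-- Coordinates of the face isomorphism: `|(faceIso x i s z)_{σ j}| = |z_j - x_j|` with `σ = swap 0 i`
(a signed coordinate permutation of `z - x`). [folklore] -/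
theorem abs_faceIso_apply_swap (x : Site 3) (i : Fin 3) (s : ℤˣ) (z : Site 3) (j : Fin 3) :
    |(faceIso x i s).toEquiv z (Equiv.swap 0 i j)| = |z j - x j| := by
  have h : (faceIso x i s).toEquiv z (Equiv.swap 0 i j) =
      (Function.update (1 : Fin 3 → ℤˣ) 0 s (Equiv.swap 0 i j) : ℤ) * (z j - x j) := by
    simp [faceIso, sub_eq_add_neg]
  rw [h, abs_mul]
  rcases Int.units_eq_one_or (Function.update (1 : Fin 3 → ℤˣ) 0 s (Equiv.swap 0 i j)) with h1 | h1 <;>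
    simp [h1]

/-- The face isomorphism maps the translated sphere `x + ∂Λ_a` to sup-distance `≥ a` from `0`. [folklore] -/
theorem exists_le_abs_faceIso_of_sub_mem_innerBoundary (x : Site 3) (i : Fin 3) (s : ℤˣ) {a : ℕ}
    {z : Site 3} (hz : z - x ∈ innerBoundary (zdGraph 3) (box 3 a)) :
    ∃ j : Fin 3, (a : ℤ) ≤ |(faceIso x i s).toEquiv z j| := by
  obtain ⟨j, hj⟩ := exists_eq_of_mem_innerBoundary_box hz
  refine ⟨Equiv.swap 0 i j, ?_⟩
  rw [abs_faceIso_apply_swap, ← Pi.sub_apply]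
  rcases hj with h | h <;> rw [h] <;> simp

/-! ## The key pointwise bound: a boundary term of `φ(Λ_{2a+1})` is at most `P(0 ↔ ∂Λ_a) · P(arm_H(0,a))` -/

/-- **Bulk arm × wall arm dominate a boundary connection.** For a boundary pair `x ∈ Λ_N ∌ y`, `x ∼ y`,
`N = 2a+1`: `P_p(0 ⟷ x in Λ_N) ≤ P_p(0 ↔ ∂Λ_a) · P_p(arm_H(0, a))` — first exit from `Λ_a`, last entrance
into `x + Λ_a` (disjoint supports since `|x_i| = 2a+1`, hence independence), and the face isomorphism at `x`.
[folklore] -/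
theorem real_openConnIn_le_siteToBoundary_mul_armH (p : unitInterval) {a : ℕ} {x y : Site 3}
    (hx : x ∈ box 3 (2 * a + 1)) (hy : y ∉ box 3 (2 * a + 1)) (hxy : (zdGraph 3).Adj x y) :
    (bondPercolation (zdGraph 3) p).real (openConnIn (↑(box 3 (2 * a + 1))) 0 x) ≤
      (bondPercolation (zdGraph 3) p).real (siteToBoundary 3 a) *
        (bondPercolation (zdGraph 3) p).real (armH a) := by
  classical
  obtain ⟨i, hi⟩ := exists_face_of_boundary_pair hx hy hxy
  -- the sign of the face: `s * x i = -N`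
  obtain ⟨s, hs1, hs⟩ : ∃ s : ℤˣ, ((s : ℤ) = 1 ∨ (s : ℤ) = -1) ∧ (s : ℤ) * x i = -((2 * a + 1 : ℕ) : ℤ) := by
    rcases hi with h | h
    · exact ⟨-1, Or.inr (by simp), by rw [h]; simp⟩
    · exact ⟨1, Or.inl (by simp), by rw [h]; simp⟩
  -- the region of the second event: `F = Λ_N ∩ (x + Λ_a)`
  set F : Finset (Site 3) := (box 3 (2 * a + 1)).filter (fun w => w - x ∈ box 3 a) with hF
  set E₂ : Set (BondConfig (Site 3)) :=
    ⋃ z : Site 3, ⋃ (_ : z - x ∈ innerBoundary (zdGraph 3) (box 3 a)), openConnIn (↑F) x z with hE₂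
  -- (1) containment, for configurations on lattice edges
  have hsub : ∀ ω : BondConfig (Site 3), ω ⊆ (zdGraph 3).edgeSet →
      ω ∈ openConnIn (↑(box 3 (2 * a + 1))) (0 : Site 3) x → ω ∈ siteToBoundary 3 a ∩ E₂ := by
    intro ω hω hωx
    have hpath := DCT16.mem_openConnIn_iff_pathIn.1 hωx
    constructor
    · -- first exit from `Λ_a`
      rw [← DCT16.armEvent_zero]
      refine DCT16.armEvent_of_pathIn hω hpath (Or.inl ?_)
      rw [sub_zero, mem_box, not_forall]
      refine ⟨i, ?_⟩
      rcases hs1 with h1 | h1 <;> rw [h1] at hs <;> push_cast at hs ⊢ <;> omega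
    · -- first exit of the reversed path from `x + Λ_a`
      have hxR : x ∈ {w : Site 3 | w - x ∈ box 3 a} := by simp
      have h0R : (0 : Site 3) ∉ {w : Site 3 | w - x ∈ box 3 a} := by
        rw [Set.mem_setOf_eq, zero_sub, mem_box, not_forall]
        refine ⟨i, ?_⟩
        rw [Pi.neg_apply]
        rcases hs1 with h1 | h1 <;> rw [h1] at hs <;> push_cast at hs ⊢ <;> omega
      obtain ⟨u, v, hu, hv, -, huv, hpre⟩ := hpath.symm.exit hxR h0R
      have hubd : u - x ∈ innerBoundary (zdGraph 3) (box 3 a) := by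
        rw [mem_innerBoundary_iff]
        refine ⟨hu, v - x, hv, ?_⟩
        rw [DCT16.zdGraph_adj_sub_iff]
        exact DCT16.adj_of_openGraph_adj hω huv
      have hpreF : PathIn (openGraph ω) (↑F) x u := by
        refine hpre.mono fun w hw => ?_
        rw [Finset.mem_coe, hF, Finset.mem_filter]
        exact ⟨hw.2, hw.1⟩
      rw [hE₂, Set.mem_iUnion]
      exact ⟨u, Set.mem_iUnion.2 ⟨hubd, DCT16.mem_openConnIn_of_pathIn hpreF⟩⟩
  -- (2) the supports are disjoint
  have hdisj : Disjoint (box 3 a).sym2 F.sym2 := by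
    refine Finset.disjoint_left.2 fun e => ?_
    refine Sym2.ind (fun u v => ?_) e
    intro h1 h2
    rw [Finset.mk_mem_sym2_iff] at h1 h2
    have hu1 := h1.1
    have hu2 := h2.1
    rw [hF, Finset.mem_filter] at hu2
    rw [mem_box] at hu1
    have hu3 := hu2.2
    rw [mem_box] at hu3
    have k1 := hu1 i
    have k2 := hu3 i
    rw [Pi.sub_apply] at k2
    rcases hs1 with h1' | h1' <;> rw [h1'] at hs <;> push_cast at hs k1 k2 <;> omega
  -- (3) locality of the two events
  have hdet₁ := DCT16.determinedBy_siteToBoundary 3 a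
  have hdet₂ : DeterminedBy E₂ (↑F.sym2 : Set (Sym2 (Site 3))) :=
    DeterminedBy.iUnion fun z => DeterminedBy.iUnion fun _ =>
      DCT16.determinedBy_openConnIn (↑F) x z (K := ↑F.sym2) (by rw [Finset.coe_sym2])
  -- (4) the second event is a half-space arm after the face isomorphism
  have hE₂le : (bondPercolation (zdGraph 3) p).real E₂ ≤ (bondPercolation (zdGraph 3) p).real (armH a) := by
    rw [← bondPercolation_real_preimage_relabel_iso (faceIso x i s) p (armH a)]
    refine measureReal_mono fun ω hω => ?_
    rw [hE₂, Set.mem_iUnion] at hω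
    obtain ⟨z, hz⟩ := hω
    rw [Set.mem_iUnion] at hz
    obtain ⟨hz, hωz⟩ := hz
    rw [Set.mem_preimage]
    have hpath := DCT16.mem_openConnIn_iff_pathIn.1 hωz
    have hH : ∀ w ∈ ((F : Finset (Site 3)) : Set (Site 3)), 0 ≤ (faceIso x i s).toEquiv w 0 := by
      intro w hw
      rw [Finset.mem_coe, hF, Finset.mem_filter, mem_box] at hw
      have hwi := hw.1 i
      rw [faceIso_apply_zero]
      rcases hs1 with h1 | h1 <;> rw [h1] at hs ⊢ <;> push_cast at hs hwi ⊢ <;> nlinarith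
    have hmap := DCT16.pathIn_map
      (G' := openGraph (BondConfig.relabel (sym2Equiv (faceIso x i s).toEquiv) ω))
      (faceIso x i s).toEquiv (B := {z : Site 3 | 0 ≤ z 0}) hH
      (fun a b _ _ hab => (openGraph_relabel_adj_iff (faceIso x i s).toEquiv ω a b).2 hab) hpath
    rw [faceIso_apply_self] at hmap
    exact ⟨(faceIso x i s).toEquiv z, exists_le_abs_faceIso_of_sub_mem_innerBoundary x i s hz,
      DCT16.mem_openConnIn_of_pathIn hmap⟩
  -- (5) assemble
  calc (bondPercolation (zdGraph 3) p).real (openConnIn (↑(box 3 (2 * a + 1))) 0 x)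
      ≤ (bondPercolation (zdGraph 3) p).real (siteToBoundary 3 a ∩ E₂) :=
        DCT16.real_mono_of_forall_subset_edgeSet (zdGraph 3) p hsub
    _ = (bondPercolation (zdGraph 3) p).real (siteToBoundary 3 a) *
          (bondPercolation (zdGraph 3) p).real E₂ :=
        DCT16.real_inter_of_determinedBy_disjoint (zdGraph 3) p hdet₁ hdet₂ hdisj
    _ ≤ (bondPercolation (zdGraph 3) p).real (siteToBoundary 3 a) *
          (bondPercolation (zdGraph 3) p).real (armH a) :=
        mul_le_mul_of_nonneg_left hE₂le measureReal_nonneg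

/-! ## The product floor -/

/-- **Bulk one-arm × wall one-arm floor at `p_c(ℤ³)`**: there is `c > 0` (`c = 1/5292`) with
`c / a² ≤ P_{p_c}(0 ↔ ∂Λ_a) · π_s(a)` for every `a ≥ 1`. From `φ_{p_c}(Λ_{2a+1}) ≥ 1`
(`one_le_phi_criticalProbI`), each of the `≤ 588 (2a+1)² ≤ 5292 a²` boundary terms being at most
`P(0 ↔ ∂Λ_a) P(arm_H(0,a))` (`real_openConnIn_le_siteToBoundary_mul_armH`). [folklore] -/
theorem bulkArm_mul_wallArm_lower : ∃ c : ℝ, 0 < c ∧ ∀ a : ℕ, 1 ≤ a → c / (a : ℝ) ^ 2 ≤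
    (bondPercolation (zdGraph 3) (criticalProbI 3)).real (siteToBoundary 3 a) * armProb (criticalProbI 3) a := by
  refine ⟨1 / 5292, by norm_num, fun a ha => ?_⟩
  rw [armProb_eq_real_armH]
  set q := (bondPercolation (zdGraph 3) (criticalProbI 3)).real (siteToBoundary 3 a) *
    (bondPercolation (zdGraph 3) (criticalProbI 3)).real (armH a) with hq
  have hφ := one_le_phi_criticalProbI (d := 3) (by norm_num) (box 3 (2 * a + 1)) (zero_mem_box 3 (2 * a + 1))
  rw [DCT16.phi_def] at hφ
  have hsum : ∑ x ∈ box 3 (2 * a + 1), ∑ y ∈ (zdGraph 3).neighborFinset x with y ∉ box 3 (2 * a + 1),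
      (bondPercolation (zdGraph 3) (criticalProbI 3)).real (openConnIn (↑(box 3 (2 * a + 1))) 0 x) ≤
      (∑ x ∈ box 3 (2 * a + 1),
        ((((zdGraph 3).neighborFinset x).filter (fun y => y ∉ box 3 (2 * a + 1))).card : ℝ)) * q := by
    rw [Finset.sum_mul]
    refine Finset.sum_le_sum fun x hx => ?_
    rw [← nsmul_eq_mul, ← Finset.sum_const]
    refine Finset.sum_le_sum fun y hy => ?_
    obtain ⟨hy1, hy2⟩ := Finset.mem_filter.1 hy
    exact real_openConnIn_le_siteToBoundary_mul_armH _ hx hy2 ((SimpleGraph.mem_neighborFinset _ _ _).1 hy1)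
  have hN := sum_card_filter_le (2 * a)
  have hpc1 : ((criticalProbI 3 : unitInterval) : ℝ) ≤ 1 := (criticalProbI 3).2.2
  have hq0 : 0 ≤ q := mul_nonneg measureReal_nonneg measureReal_nonneg
  have hS0 : 0 ≤ ∑ x ∈ box 3 (2 * a + 1), ∑ y ∈ (zdGraph 3).neighborFinset x with y ∉ box 3 (2 * a + 1),
      (bondPercolation (zdGraph 3) (criticalProbI 3)).real (openConnIn (↑(box 3 (2 * a + 1))) 0 x) :=
    Finset.sum_nonneg fun _ _ => Finset.sum_nonneg fun _ _ => measureReal_nonneg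
  have ha1 : (1 : ℝ) ≤ a := by exact_mod_cast ha
  have h1 : (1 : ℝ) ≤ 5292 * (a : ℝ) ^ 2 * q := by
    calc (1 : ℝ) ≤ _ := hφ
      _ ≤ 1 * ((∑ x ∈ box 3 (2 * a + 1),
            ((((zdGraph 3).neighborFinset x).filter (fun y => y ∉ box 3 (2 * a + 1))).card : ℝ)) * q) :=
          mul_le_mul hpc1 hsum hS0 zero_le_one
      _ ≤ 1 * (588 * (((2 * a : ℕ) : ℝ) + 1) ^ 2 * q) := by gcongr
      _ = 588 * (2 * (a : ℝ) + 1) ^ 2 * q := by push_cast; ring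
      _ ≤ 588 * (3 * (a : ℝ)) ^ 2 * q := by gcongr; linarith
      _ = 5292 * (a : ℝ) ^ 2 * q := by ring
  rw [div_div, div_le_iff₀ (by positivity)]
  linarith

/-- **The wall arm divided by the bulk arm**: `c / (a² · P_{p_c}(0 ↔ ∂Λ_a)) ≤ π_s(a)` for `a ≥ 1`, with the
constant of `bulkArm_mul_wallArm_lower` (`P_{p_c}(0 ↔ ∂Λ_a) > 0` as it dominates the product floor).
[folklore] -/
theorem armProb_criticalProbI_ge_div_bulkArm : ∃ c : ℝ, 0 < c ∧ ∀ a : ℕ, 1 ≤ a →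
    c / ((a : ℝ) ^ 2 * (bondPercolation (zdGraph 3) (criticalProbI 3)).real (siteToBoundary 3 a)) ≤
      armProb (criticalProbI 3) a := by
  obtain ⟨c, hc, h⟩ := bulkArm_mul_wallArm_lower
  refine ⟨c, hc, fun a ha => ?_⟩
  have key := h a ha
  have ha0 : (0 : ℝ) < (a : ℝ) ^ 2 := by
    have : (0 : ℝ) < a := by exact_mod_cast ha
    positivity
  have hθ0 : 0 ≤ (bondPercolation (zdGraph 3) (criticalProbI 3)).real (siteToBoundary 3 a) :=
    measureReal_nonneg
  rcases hθ0.lt_or_eq with hθ | hθ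
  · rw [← div_div, div_le_iff₀ hθ]
    calc c / (a : ℝ) ^ 2 ≤ _ := key
      _ = armProb (criticalProbI 3) a *
          (bondPercolation (zdGraph 3) (criticalProbI 3)).real (siteToBoundary 3 a) := mul_comm _ _
  · -- degenerate (impossible) case `P(0 ↔ ∂Λ_a) = 0`: the left side is `c / 0 = 0`
    rw [← hθ, mul_zero, div_zero]
    exact armProb_nonneg _ _

end Summit.CriticalPhenomena.PercolationContinuityZ3.Theorems.TallClusterMassBound.ReplicaOverlap
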